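import Literature.MathematicalPhysics.QuantumFieldTheory.Balaban1983to89.B9ThmDCommutatorStep

/-!
# `Balaban1983to89.B9ThmDCommutatorStepAdj` — THEOREM D FOR THE RECORD'S LETTERS, FILE E3b: THE ADJOINT-ORDERED COMMUTATOR STEP
# `T_χ := G′_□(V)·[Δ′_{a,□}(V), M_{χ_□}]` HAS A MEMBER-UNIFORM BLOCK MAJORANT `θ_T·e^{−(1−α′)(1−α)δ·d_□}` OVER THE CUBE SEQUENCE'S BLOCKS
# (sub-row G-B9-LETTERS, GAPS G-B9-05 ∕ G-B9-p33-01, programme FAMTHREE FILE F3-E3b — the cube-side half of the supplier of F3-E3's displayed input `hGK`;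
# design `lit-balaban-p38/F3E3b-SCOPE.md`; lead g35 RULING FAMTHREE-5a (4); seat p38 gen 48)

T. Bałaban, *Propagators for lattice gauge theories in a background field*, Commun. Math. Phys. **99** (1985) 389–434 [`Balaban1985BackgroundPropagators`, "[B9]"];
[4] = T. Bałaban, *Propagators and renormalization transformations for lattice gauge theories. II*, Commun. Math. Phys. **96** (1984) 223–250 [`Balaban1984PropagatorsII`];
[B4-I] = T. Bałaban, *Propagators and renormalization transformations for lattice gauge theories. I*, Commun. Math. Phys. **95** (1984) 17–40 [`Balaban1984PropagatorsI`].

statement-level skeleton of published theorems with citation tags; proofs where landed; nothing here is a claim about the Yang–Mills mass gap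

THE PRINTED LOCUS (held `paper:balaban1985-cmp99-background-propagators`, journal page = PDF page + 388).  (3.88) p. 409 defines the commutator letter `K(h)` by
«(Δ′_a hλ)(x) = h(x)(Δ′_aλ)(x) − (K(h)λ)(x)» (so `K(h) = hΔ′_a − Δ′_ah`, our reading) and (3.89) p. 409 is «|(K(h_□)G′_□h_□λ)(x)| ≦ O(M⁻¹)e^{−δ₀d(y,y′)}|λ|» (kernel
form); in the sequel print uses the commutator on EITHER side of `G′_□` (p. 415 l. 29–31 «we replace the operators G′_{□₀} and C_{□₀} by G′_□, C_□, terms with the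
differences … are small by the same reason as before»; p. 412 l. 1–9, l. 22–36 — our gloss); (3.100) p. 413 «(D_μhA_ν)(x) = h(x)(D_μA_ν)(x) +
(∂_μh)(x)R(U(x, x+ηe_μ))A_ν(x+ηe_μ), similarly for adjoint derivatives» (the Leibniz rule); Thm 3.1 (3.42) p. 397 «|(G′(U)λ)(x)|, |(∇_UG′(U)λ)(x)|,
|(G′(U)∇*_Uλ)(x)|, |(Δ_UG′(U)λ)(x)| ≦ B₀[(Lʲη)², Lʲη, Lʲη, 1]e^{−δ₀d(y,y′)}|λ|» (FIRST and THIRD members); (3.24) p. 394, (3.59) p. 402 (the averaging term);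
[4] p. 247 «|∂h_□| ≤ O(1)(MLʲη)⁻¹»; [4] (2.51)–(2.55) pp. 232–233, Lemma 2.1 (2.60)–(2.63) p. 234, p. 398 of [B9] (remark after (3.47): scale transfer); [B4-I]
(1.118) p. 36 (the cut-off `χ_□`).

WHY THIS FILE.  p38 g47's F3-E3 `B9Eq3105FamThreeLocDiffGRight.hasMajorant_hDR_at` supplies the RIGHT-located `G′`-difference entry `hDR` of family 3 of (3.105)
modulo ONE displayed input `hGK`: a member-carrier kernel `θ_K·e^{−b_Kδ₀d}` of `conj b(T_χ^ℝ)` for the ADJOINT-ORDERED cube letter `T_χ = G′_□(V′)·(Δ′_□(V′)M_{χ_□} −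
M_{χ_□}Δ′_□(V′))`.  p21 D3 `B9ThmDCommutatorStep.hasMajorant_conj_commStep` bounds the OTHER order `R_χ = [M_{χ_□}, Δ′_□]·G′_□` (rows in the transition annulus) by
reading the ROW entries `∇G′_□`, `∇*G′_□`, `ΔG′_□` of (3.42) at the row.  For `T_χ` the cut-off's differences sit at the COLUMN variable while the row of `G′_□` is global:
a bound from entry 0 alone carries `ℓ_□(a)²η⁻²∕S_j`, unbounded over coarse rows.  THIS FILE proves the bound that works (design note `F3E3b-SCOPE.md`): §2's
SUMMATION BY PARTS `[Δ_V, M_χ] = Σ_ν ∇*_{V,ν}∘M_{∂_νχ}∘(∇_{V,ν} + 1) + Σ_ν ∇*_{V,ν}∘M_{∂_νχ} − M_{σχ}` puts every derivative in FRONT of the cut-off weights, so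
`G′_□∘[Δ′_□, M_χ]` reads the COLUMN entry `G′_□∘(−η⁻¹∇*_ν)` of (3.42)₃ (the fourth conjunct of p33 7b-C `B9Cor36GpCubeEntriesAtV.gp_cube_entries_at_locCfg`) against
`|η⁻¹∂χ_□| ≤ D₁θ∕4·ℓ_□⁻¹`, entry 0 against `|η⁻²σχ_□| ≤ (d+1)3D₂θ∕16·ℓ_□⁻²` and against the block-local averaging commutator `η⁻²[A_□, M_χ]` (`≤ 2(1 + C_qα₁)²ℓ_□⁻²`);
the inverse lengths at the source end are moved to the row by [4] (2.60) (`e^{−αδd(a,e)}ℓ(e)⁻ⁿ ≤ Λℓ(a)⁻ⁿ`), cancelling the `ℓ` resp. `ℓ²` of the entries — the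
kernel is `ℓ`-FREE, i.e. member-uniform; the covariant shift `τ_{V,ν} = ∇_{V,ν} + 1` inside the first sum is a short-range letter (stencil `d ≤ 1`) and costs one
(2.61) chain sum.  FILE E3c (`B9Eq3105FamThreeCommStepAdjAtDatum`) reads this at the (3.35) datum and transfers it to the member's carrier (= `hGK`).

WHAT THIS FILE PROVES (THEOREMS only; 0 `def`; 0 sorry; standard axioms).
* §1 rules of [4]'s calculus: ★ `hasMajorant_weighted_mul_shift_one` (`Y ≺ Aℓ(a)e^{−δd}·rℓ(a′)⁻¹`, `S ≺ κe^{−(1−α)δd}` ⟹ `Y·S ≺ ArΛκc₁²·e^{−(1−α′)(1−α)δd}` — the `ℓ¹`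
  twin of p33's `hasMajorant_weighted_mul_shift`), `weight_transfer_pointwise`, `hasMajorant_mul_mulOp_colWeight`, `norm_coordSymm_le_of_blockSupp`,
  ★ `hasMajorant_conj_covShift` (`conj b(∇_{V,ν} + 1) ≺ M₂Σ‖b_j‖κ_V·e^{θ}e^{−θd}` under `‖R(V_ν(z))a‖ ≤ κ_V‖a‖`).
* §2 ★★ `cdsS_cdS_comm_apply`, `lapSL_comm_cutMulY` (the summation-by-parts identity for ANY real multiplier `h`), `deltaPrimeACubeY_comm_cutMulY`.
* §3 print's units: `G_cdsSL_cutMulY_mul_eq` ∕ `G_cdsSL_cutMulY_eq` ∕ `G_cutMulY_eq` ∕ `G_mul_eq_smul` (`η²·η⁻¹·η⁻¹ = 1`, `η²·η⁻² = 1`), ★★ `conj_commStepAdj_eq` —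
  `conj b(T_χ^ℝ)` as a signed sum of products of the (3.42) letters `conj b(η²G′_□)`, `conj b(−η⁻¹∇*_ν)` with `η`-free local factors.
* §4 `abs_dchi_le`, `abs_sigma_chi_le` (the cut-off weights, p21∕p33 `chiY_weights`), ★ `norm_avgComm_apply_le`, ★★★ `hasMajorant_conj_commStepAdj`:
  `conj b((G′_□(V)(Δ′_□(V)M_{χ_□} − M_{χ_□}Δ′_□(V)))^ℝ) ≺ θ_T·e^{−(1−α′)(1−α)δ·d_□}` over `(toB6 (geoCK i □) Rr H, blkCubeY)`,
  `θ_T = (d+1)·(B_f(D₁θ∕4)Λ₁·M₂Σ‖b_j‖κ_Ve^{(1−α)δ}c₁(dB,(1−α)δ,α′)² + B_f(D₁θ∕4)Λ₁) + B_f(d+1)(3D₂θ∕16)Λ₂ + B_f·2(1 + C_qα₁)²M₂Σ‖b_j‖·Λ₂` — NO `L^j`, NO `η`.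

HONEST SCOPE ∕ NOT CLAIMED.  Lattice units `η = (kGeo i).eta`; `𝔸` a complete normed `ℂ`-algebra with `‖1‖ ≤ 1`, real basis `b` with coordinate bound `M₂`; `V`, `par`
arbitrary (instantiated at `Ṽ_□`, `parSymY` in FILE E3c); the two (3.42) entries, the rotation bound `κ_V`, the (3.59) sizes `hkF`∕`hsF`, the two scale transfers
and (2.61) are HYPOTHESES here (discharged in E3c from p33's cube packages, `hST_geoCK`, `exists_h261_geoCK`, `norm_mulDefF_apply_le`).  Print's `O(M⁻¹)` of (3.89) is
NOT claimed (the consumer F3-E3's smallness is the collar factor `e^{−a_sepδ₀(3M_h∕8 − 3)}`); the derivation (summation by parts instead of print's «similarly») is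
OURS — a LABELLED DEVIATION in the cell's RULINGS #7∕#10 pattern, as for p21's D-files.  Count-neutral; NOT a node discharge; no summit ∕ sub-problem statement is
proved; nothing continuum ∕ OS ∕ mass-gap ∕ Clay; YM mass gap NOT proved (Track A conditional rung).  No `sorry`, no `axiom`, no `… : Prop` fact, no `instance`, no
`notation`, no `def`.  NEW file; nothing landed is modified.  Cell `lit-balaban`, seat `lit-balaban-p38` gen 48, 2026-08-29; `--supports stmt-QuantumFields-19200` as
helper.  Net new unproved facts: 0.

RELATED IN THE TREE, NOT DUPLICATED (searched 2026-08-29: `rg 'commStepAdj|covShift|weighted_mul_shift_one|lapSL_comm_cutMulY' Literature/` = ∅): p21 D3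
`B9ThmDCommutatorStep` (the other order — its `chiY_weights`-driven sizes are the model; NOT reusable for `T_χ`), p33 7b-C `B9Cor36GpCubeEntriesAtV`
(`hasMajorant_weighted_mul_shift` — the `ℓ²` rule; `norm_avgCube_apply_le`, `hasMajorant_one_decay` BY NAME), p38 `B9Cor36SiteSandwichTransfer` (`rowLocal_conj_of_local`,
`hasMajorant_mul_of_rowLocal_right` BY NAME), p38 F3-E3 `B9Eq3105FamThreeLocDiffGRight.hasMajorant_mul_mulOp_right_weight` (same rule as `hasMajorant_mul_mulOp_colWeight`
on a `toB6` carrier; restated here for a general geometry in 4 lines rather than importing F3-E3's 819-line module below it), F3-E1 `B9Eq3105FamThreeLocDiffG`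
∕ `B9Cor36CutoffField337` ((3.100) behind a cut-off as OPERATOR identities for one derivative; §2 here is the second-order, two-sided version, proved pointwise),
`B9Cor36CutoffSecondDiff.chiY_weights`, `B9CubeGeometryInputs.stencil_geoCK`, `B9Ineq349SiteComposite.cdSL`∕`cdsSL` — all USED BY NAME.
-/

noncomputable section

namespace Literature.MathematicalPhysics.QuantumFieldTheory.Balaban1983to89.B9ThmDCommutatorStepAdj

open B6RandomWalk (HasMajorant BlockSupp hasMajorant_mono hasMajorant_add hasMajorant_mul Ineq261 Triangle254 c1_nonneg)
open B9Thm34Ext (toB6)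
open B9Thm37Sum (mulOp mulOp_apply)
open B6KLevelCensusIndexV1 (KIdx kGeo)
open B6Cover236MultiLevelBlocks (cubes)
open B9Eq352DivFormLetters (conj conj_apply conj_mul conj_sub conj_neg coordEquiv coordEquiv_symm_apply norm_coordSymm_apply_le)
open B9Eq352GradLetters (diffLetter)
open B9Eq39Adjoint (R R_add R_sub R_smul R_zero R_inv_R)
open B9Eq360DeltaPrimeACubeY (blkCubeY kFCubeY sFCubeY)
open B9CubeLettersOpsL0 (deltaPrimeACubeY avgCoeffCubeY avgTrCubeY GpCubeY)
open B9CubeLettersBondOpsL0 (BlkCubeY)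
open B9CubeGeometryInputs (geoCK geoCK_eta geoCK_eta_pos geoCK_len_pos geoCK_dist_axioms stencil_geoCK geoCK_eta_le_len)
open B9Cor35GpCubeInputsAtOne (wK hasMajorant_neg)
open B9Cor36CubeCutoffs (chiY abs_chiY_le_one)
open B9Cor36CutoffSecondDiff (chiY_weights)
open B9Cor36GpCubeEntriesAtV (norm_avgCube_apply_le)
open B9Cor36GpCubeLocAtMember (diffLetter_inr_apply hasMajorant_finset_sum hasMajorant_congr_op)
open B9Cor36SiteSandwichTransfer (hasMajorant_mul_of_rowLocal_right rowLocal_conj_of_local)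
open B9Ineq349SiteComposite (cdSL cdsSL cdSL_apply cdsSL_apply)
open B9Thm37CubeCoverCommutators (cutMulY cutMulY_apply)
open B9Thm39CinvTorusRegular (conj_cutMulY)
open B4PartitionUnity22 (thetaProf D1 D2 D1_nonneg D2_nonneg contDiff_thetaProf hasCompactSupport_thetaProf)
open Node00 (SiteY CfgY SiteParY toKT shiftY UboxY lapSL lapSL_apply lapS cdS cdsS cdS_smul cdsS_smul kernelTrOpY)

variable {d ℓ : ℕ} {hd : 1 ≤ d + 1} {hL : Odd (ℓ + 1) ∧ 1 < ℓ + 1} {b₀ b₁ : ℝ}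
variable {𝔸 : Type} [NormedRing 𝔸] [NormedAlgebra ℂ 𝔸] [CompleteSpace 𝔸]
variable {ι : Type} [Fintype ι]
variable (i : KIdx d ℓ hd hL b₀ b₁) (c : ↥(cubes (toKT i).D.toDomains))

/-! ## §1  Two rules of [4]'s majorant calculus: a column-weighted `ℓ¹` kernel followed by a short-range letter; the covariant shift -/

section Rules

/-- ★ **WEIGHTED `ℓ¹` KERNEL ∘ SHORT-RANGE LETTER** (the `ℓ¹` twin of p33 7b-C's `hasMajorant_weighted_mul_shift`): `Y ≺ A·ℓ(a)·e^{−δd(a,a′)}·r·ℓ(a′)⁻¹`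
(a source weight `ℓ⁻¹`) and `S ≺ κ·e^{−(1−α)δd}`, with the scale transfer `e^{−αδd(a,e)}ℓ(e)⁻¹ ≤ Λℓ(a)⁻¹` ([4] (2.60)), the triangle inequality and (2.61) at
`((1−α)δ, α′)` ⟹ `Y·S ≺ A·r·Λ·κ·c₁²·e^{−(1−α′)(1−α)δd}` — an `ℓ`-FREE (member-uniform) kernel.
[cite: Balaban1984PropagatorsII, (2.52)–(2.55) pp.232–233, (2.60)–(2.63) p.234; Balaban1985BackgroundPropagators, p.398 (scale transfer), (3.89) p.409] -/
theorem hasMajorant_weighted_mul_shift_one {X : Type} (Rr : ℝ) (H : Prop) (blk : X → BlkCubeY i c) (dB : ℕ) {δ α α' r A Λ κ : ℝ}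
    (hr : 0 ≤ r) (hA : 0 ≤ A) (hΛ : 0 ≤ Λ) (hκ : 0 ≤ κ) (hδ' : 0 ≤ (1 - α) * δ) (hα'1 : α' ≤ 1)
    (htri : Triangle254 (toB6 (geoCK i c) Rr H))
    (hST : ∀ a e : BlkCubeY i c, Real.exp (-(α * δ * (geoCK i c).dist a e)) * ((geoCK i c).len e)⁻¹ ≤ Λ * ((geoCK i c).len a)⁻¹)
    (h261 : Ineq261 dB (toB6 (geoCK i c) Rr H) ((1 - α) * δ) α')
    {S Y : Module.End ℝ (X → ℝ)}
    (hY : HasMajorant (g := toB6 (geoCK i c) Rr H) blk Y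
      (fun a a' => A * (geoCK i c).len a * Real.exp (-(δ * (geoCK i c).dist a a')) * (r * ((geoCK i c).len a')⁻¹)))
    (hS : HasMajorant (g := toB6 (geoCK i c) Rr H) blk S
      (fun a a' => κ * Real.exp (-((1 - α) * δ * (geoCK i c).dist a a')))) :
    HasMajorant (g := toB6 (geoCK i c) Rr H) blk (Y * S)
      (fun a a' => A * r * Λ * κ * B6.c1 dB ((1 - α) * δ) α' ^ 2 *
        Real.exp (-((1 - α') * ((1 - α) * δ) * (geoCK i c).dist a a'))) := by
  have hlen0 : ∀ a : BlkCubeY i c, 0 ≤ (geoCK i c).len a := fun a => (geoCK_len_pos i c a).le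
  have hK₂ : ∀ a a' : BlkCubeY i c, 0 ≤ κ * Real.exp (-((1 - α) * δ * (geoCK i c).dist a a')) := fun a a' =>
    mul_nonneg hκ (Real.exp_nonneg _)
  have h263 := B6RandomWalk.ineq263_of_261 dB (toB6 (geoCK i c) Rr H) ((1 - α) * δ) α' htri hδ' hα'1 h261 1
  refine hasMajorant_mono (g := toB6 (geoCK i c) Rr H) _ (B6RandomWalk.hasMajorant_mul (g := toB6 (geoCK i c) Rr H) blk hY hS hK₂) fun a a'' => ?_
  have hterm : ∀ e : BlkCubeY i c,
      A * (geoCK i c).len a * Real.exp (-(δ * (geoCK i c).dist a e)) * (r * ((geoCK i c).len e)⁻¹) *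
          (κ * Real.exp (-((1 - α) * δ * (geoCK i c).dist e a''))) ≤
        A * r * Λ * κ *
          (Real.exp (-((1 - α) * δ * (geoCK i c).dist a e)) * Real.exp (-((1 - α) * δ * (geoCK i c).dist e a''))) := by
    intro e
    have hsplit : Real.exp (-(δ * (geoCK i c).dist a e)) = Real.exp (-(α * δ * (geoCK i c).dist a e)) * Real.exp (-((1 - α) * δ * (geoCK i c).dist a e)) := by
      rw [← Real.exp_add]; ring_nf
    have h1 := hST a e
    have hl1 : (geoCK i c).len a * (Λ * ((geoCK i c).len a)⁻¹) = Λ := by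
      have := (geoCK_len_pos i c a).ne'
      field_simp
    have hpre : 0 ≤ A * r * κ * Real.exp (-((1 - α) * δ * (geoCK i c).dist a e)) * Real.exp (-((1 - α) * δ * (geoCK i c).dist e a'')) :=
      mul_nonneg (mul_nonneg (mul_nonneg (mul_nonneg hA hr) hκ) (Real.exp_nonneg _)) (Real.exp_nonneg _)
    calc A * (geoCK i c).len a * Real.exp (-(δ * (geoCK i c).dist a e)) * (r * ((geoCK i c).len e)⁻¹) *
          (κ * Real.exp (-((1 - α) * δ * (geoCK i c).dist e a'')))
        = (A * r * κ * Real.exp (-((1 - α) * δ * (geoCK i c).dist a e)) * Real.exp (-((1 - α) * δ * (geoCK i c).dist e a''))) *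
          ((geoCK i c).len a * (Real.exp (-(α * δ * (geoCK i c).dist a e)) * ((geoCK i c).len e)⁻¹)) := by rw [hsplit]; ring
      _ ≤ (A * r * κ * Real.exp (-((1 - α) * δ * (geoCK i c).dist a e)) * Real.exp (-((1 - α) * δ * (geoCK i c).dist e a''))) *
          ((geoCK i c).len a * (Λ * ((geoCK i c).len a)⁻¹)) :=
          mul_le_mul_of_nonneg_left (mul_le_mul_of_nonneg_left h1 (hlen0 a)) hpre
      _ = _ := by rw [hl1]; ring
  have hchain := h263 a a''
  simp only [B6RandomWalk.chain] at hchain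
  have hpre2 : 0 ≤ A * r * Λ * κ := mul_nonneg (mul_nonneg (mul_nonneg hA hr) hΛ) hκ
  calc ∑ e, A * (geoCK i c).len a * Real.exp (-(δ * (geoCK i c).dist a e)) * (r * ((geoCK i c).len e)⁻¹) *
          (κ * Real.exp (-((1 - α) * δ * (geoCK i c).dist e a'')))
      ≤ ∑ e, A * r * Λ * κ *
          (Real.exp (-((1 - α) * δ * (geoCK i c).dist a e)) * Real.exp (-((1 - α) * δ * (geoCK i c).dist e a''))) := Finset.sum_le_sum fun e _ => hterm e
    _ = A * r * Λ * κ * ∑ e, Real.exp (-((1 - α) * δ * (geoCK i c).dist a e)) * Real.exp (-((1 - α) * δ * (geoCK i c).dist e a'')) := by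
        rw [Finset.mul_sum]
    _ ≤ A * r * Λ * κ * (B6.c1 dB ((1 - α) * δ) α' ^ (1 + 1) * Real.exp (-((1 - α') * ((1 - α) * δ) * (geoCK i c).dist a a''))) :=
        mul_le_mul_of_nonneg_left hchain hpre2
    _ = _ := by ring

/-- a pointwise transfer of one source weight: `ℓ(a)ⁿ·e^{−δd}·(r·ℓ(a′)⁻ⁿ) ≤ r·Λ·e^{−(1−α)δd}` from `e^{−αδd(a,a′)}ℓ(a′)⁻ⁿ ≤ Λℓ(a)⁻ⁿ` (no block sum).
[cite: Balaban1984PropagatorsII, Lemma 2.1 (2.60) p.234; Balaban1985BackgroundPropagators, p.398 remark after (3.47)] -/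
theorem weight_transfer_pointwise {δ α r Λ A la la' t : ℝ} (hr : 0 ≤ r) (hA : 0 ≤ A) (hla : 0 < la)
    (hST : Real.exp (-(α * δ * t)) * la'⁻¹ ≤ Λ * la⁻¹) :
    A * la * Real.exp (-(δ * t)) * (r * la'⁻¹) ≤ A * r * Λ * Real.exp (-((1 - α) * δ * t)) := by
  have hsplit : Real.exp (-(δ * t)) = Real.exp (-(α * δ * t)) * Real.exp (-((1 - α) * δ * t)) := by
    rw [← Real.exp_add]; ring_nf
  have hl1 : la * (Λ * la⁻¹) = Λ := by
    have := hla.ne'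
    field_simp
  have hpre : 0 ≤ A * r * Real.exp (-((1 - α) * δ * t)) := mul_nonneg (mul_nonneg hA hr) (Real.exp_nonneg _)
  calc A * la * Real.exp (-(δ * t)) * (r * la'⁻¹)
      = (A * r * Real.exp (-((1 - α) * δ * t))) * (la * (Real.exp (-(α * δ * t)) * la'⁻¹)) := by rw [hsplit]; ring
    _ ≤ (A * r * Real.exp (-((1 - α) * δ * t))) * (la * (Λ * la⁻¹)) := mul_le_mul_of_nonneg_left (mul_le_mul_of_nonneg_left hST hla.le) hpre
    _ = _ := by rw [hl1]; ring

omit [CompleteSpace 𝔸] in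
/-- ★ **A REAL MULTIPLIER AT THE SOURCE END WEIGHS A MAJORANT BY ITS COLUMN COEFFICIENT**: `T ≺ K`, `|f(x)| ≤ w(Δ(x))`, `w ≥ 0` ⟹ `T·M_f ≺ K(a,a′)·w(a′)`
(a row-local right factor, [4] (2.52); no block sum). [cite: Balaban1984PropagatorsII, (2.52) p.232 («a block-diagonal factor»), (2.51) p.232] -/
theorem hasMajorant_mul_mulOp_colWeight {X : Type} {g : B6.Geometry} (blk : X → g.Site) {T : Module.End ℝ (X → ℝ)} {K : g.Site → g.Site → ℝ}
    (hT : HasMajorant (g := g) blk T K) (f : X → ℝ) (w : g.Site → ℝ) (hw : ∀ a, 0 ≤ w a) (hf : ∀ x, |f x| ≤ w (blk x)) :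
    HasMajorant (g := g) blk (T * mulOp f) (fun a a' => K a a' * w a') :=
  hasMajorant_mul_of_rowLocal_right (g := g) blk w hw (fun μ x M hM => by
    rw [mulOp_apply, abs_mul]
    exact mul_le_mul (hf x) (hM x rfl) (abs_nonneg _) (hw _)) hT

variable (b : Module.Basis ι ℝ 𝔸)

omit [CompleteSpace 𝔸] in
/-- the source of [4]'s (2.51) reading in `𝔸`: `‖(coord⁻¹μ)(x)‖ ≤ Σ‖b_j‖·B` on the source block and `= 0` off it.
[cite: Balaban1984PropagatorsII, (2.51) p.232, bookkeeping] -/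
theorem norm_coordSymm_le_of_blockSupp {X : Type} {g : B6.Geometry} (blk : X → g.Site) {μ : X × ι → ℝ} {y' : g.Site} {B : ℝ}
    (hμ : BlockSupp (g := g) (fun p : X × ι => blk p.1) μ y' B) (x : X) :
    ‖(coordEquiv b).symm μ x‖ ≤ (∑ j, ‖b j‖) * B ∧ (blk x ≠ y' → (coordEquiv b).symm μ x = 0) := by
  refine ⟨norm_coordSymm_apply_le b μ x B fun j => ?_, fun hx => ?_⟩
  · by_cases hx : blk x = y'
    · exact hμ.bound (x, j) hx
    · rw [hμ.off (x, j) hx, abs_zero]; exact hμ.nonneg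
  · rw [coordEquiv_symm_apply]
    exact Finset.sum_eq_zero fun j _ => by rw [hμ.off (x, j) hx, zero_smul]

/-- ★ **THE COVARIANT SHIFT `τ_{V,ν} = ∇_{V,ν} + 1`, `(τ_{V,ν}f)(z) = R(V_ν(z))f(z + e_ν)`, HAS THE STENCIL MAJORANT `M₂Σ‖b_j‖·κ_V·e^{θ}·e^{−θd}`** over the
cube sequence's blocks, for a field with `‖R(V_ν(z))a‖ ≤ κ_V‖a‖` (the blocks of `z` and `z + e_ν` are at distance `≤ 1`, `stencil_geoCK`).
[cite: Balaban1985BackgroundPropagators, (3.3) p.390, p.403 l.1–9; Balaban1984PropagatorsII, (2.51) p.232, (2.46) p.231] -/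
theorem hasMajorant_conj_covShift {M₂ : ℝ} (hM₂ : 0 ≤ M₂) (hrepr : ∀ (v : 𝔸) (j : ι), |b.repr v j| ≤ M₂ * ‖v‖)
    (Rr : ℝ) (H : Prop) (V : CfgY 𝔸 i) {κV : ℝ} (hκV : 0 ≤ κV) (hRV : ∀ (ν : Fin (d + 1)) (z : SiteY i) (a : 𝔸), ‖R (UboxY i V ν z) a‖ ≤ κV * ‖a‖)
    {θ : ℝ} (hθ : 0 ≤ θ) (ν : Fin (d + 1)) :
    HasMajorant (g := toB6 (geoCK i c) Rr H) (fun p : SiteY i × ι => blkCubeY i c p.1)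
      (conj b ((cdSL i V ν + 1).restrictScalars ℝ))
      (fun a a' => M₂ * (∑ j, ‖b j‖) * κV * Real.exp θ * Real.exp (-(θ * (geoCK i c).dist a a'))) := by
  intro y' μ B hμ p
  have hB : 0 ≤ B := hμ.nonneg
  have hSb : 0 ≤ ∑ j, ‖b j‖ := Finset.sum_nonneg fun _ _ => norm_nonneg _
  set Λ : SiteY i → 𝔸 := (coordEquiv b).symm μ with hΛdef
  have e : ((cdSL i V ν + 1).restrictScalars ℝ) Λ p.1 = R (UboxY i V ν p.1) (Λ (shiftY i ν p.1)) := by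
    rw [LinearMap.restrictScalars_apply, LinearMap.add_apply, Pi.add_apply, cdSL_apply, Module.End.one_apply]
    show R (UboxY i V ν p.1) (Λ (shiftY i ν p.1)) - Λ p.1 + Λ p.1 = _
    abel
  rw [conj_apply, ← hΛdef, e]
  obtain ⟨hnorm, hoff⟩ := norm_coordSymm_le_of_blockSupp b (g := toB6 (geoCK i c) Rr H) (blkCubeY i c) hμ (shiftY i ν p.1)
  rw [← hΛdef] at hnorm hoff
  have hpre : 0 ≤ M₂ * (∑ j, ‖b j‖) * κV * Real.exp θ * Real.exp (-(θ * (geoCK i c).dist (blkCubeY i c p.1) y')) * B := by positivity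
  by_cases hx : blkCubeY i c (shiftY i ν p.1) = y'
  · have hd1 : (geoCK i c).dist (blkCubeY i c p.1) y' ≤ 1 := by rw [← hx]; exact (stencil_geoCK i c).2.1 ν p.1
    have hexp : 1 ≤ Real.exp θ * Real.exp (-(θ * (geoCK i c).dist (blkCubeY i c p.1) y')) := by
      rw [← Real.exp_add]
      exact Real.one_le_exp (by nlinarith)
    calc |b.repr (R (UboxY i V ν p.1) (Λ (shiftY i ν p.1))) p.2| ≤ M₂ * ‖R (UboxY i V ν p.1) (Λ (shiftY i ν p.1))‖ := hrepr _ _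
      _ ≤ M₂ * (κV * ((∑ j, ‖b j‖) * B)) := mul_le_mul_of_nonneg_left ((hRV ν p.1 _).trans (mul_le_mul_of_nonneg_left hnorm hκV)) hM₂
      _ = M₂ * (∑ j, ‖b j‖) * κV * 1 * B := by ring
      _ ≤ M₂ * (∑ j, ‖b j‖) * κV * (Real.exp θ * Real.exp (-(θ * (geoCK i c).dist (blkCubeY i c p.1) y'))) * B :=
          mul_le_mul_of_nonneg_right (mul_le_mul_of_nonneg_left hexp (by positivity)) hB
      _ = _ := by ring
  · rw [hoff hx, R_zero, map_zero, Finsupp.zero_apply, abs_zero]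
    exact hpre

end Rules

/-! ## §2  Summation by parts: `[Δ_V, M_h] = Σ_ν ∇*_{V,ν}∘M_{∂_νh}∘(τ_{V,ν} + 1) − M_{σh}` — every derivative in front -/

section Identity

/-- one direction `ν`, evaluated: `∇*_ν∇_ν(hΛ)(z) − h(z)·∇*_ν∇_νΛ(z) = ∇*_ν(∂_νh·(τ_νΛ))(z) + ∇*_ν(∂_νh·Λ)(z) − (2h(z) − h(z+e_ν) − h(z−e_ν))Λ(z)`,
`∂_νh = h(· + e_ν) − h`, `τ_νΛ = R(V_ν)Λ(· + e_ν)` (`R(W⁻¹)R(W) = 1`, `(z − e_ν) + e_ν = z`). [cite: Balaban1985BackgroundPropagators, (3.3) p.390, (3.8) p.392, (3.23) p.394, (3.88) p.409, (3.100) p.413] -/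
theorem cdsS_cdS_comm_apply (V : CfgY 𝔸 i) (h : SiteY i → ℝ) (ν : Fin (d + 1)) (Λ : SiteY i → 𝔸) (z : SiteY i) :
    cdsS i V ν (cdS i V ν (cutMulY h Λ)) z - (((h z : ℝ)) : ℂ) • cdsS i V ν (cdS i V ν Λ) z =
      cdsS i V ν (cutMulY (fun w => h (shiftY i ν w) - h w) ((cdSL i V ν + 1) Λ)) z +
        cdsS i V ν (cutMulY (fun w => h (shiftY i ν w) - h w) Λ) z -
          (((2 * h z - h (shiftY i ν z) - h ((shiftY i ν).symm z) : ℝ)) : ℂ) • Λ z := by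
  have hz : shiftY i ν ((shiftY i ν).symm z) = z := Equiv.apply_symm_apply _ _
  have eτ : ∀ w, ((cdSL i V ν + 1) Λ) w = R (UboxY i V ν w) (Λ (shiftY i ν w)) := fun w => by
    rw [LinearMap.add_apply, Pi.add_apply, cdSL_apply, Module.End.one_apply]
    show R (UboxY i V ν w) (Λ (shiftY i ν w)) - Λ w + Λ w = _
    abel
  simp only [cdsS, cdS, B9Eq39Adjoint.covDstar, B9Eq39Adjoint.covD, cutMulY_apply, eτ, hz, R_sub, R_smul, R_inv_R]
  push_cast
  module

/-- ★★ **SUMMATION BY PARTS FOR THE CUT-OFF COMMUTATOR**: `Δ_V∘M_h − M_h∘Δ_V = Σ_ν (∇*_{V,ν}∘M_{∂_νh}∘(∇_{V,ν} + 1) + ∇*_{V,ν}∘M_{∂_νh}) − M_{σh}` with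
`∂_νh = h(· + e_ν) − h`, `σh = Σ_ν (2h − h(· + e_ν) − h(· − e_ν))` — the derivatives stand in FRONT of the multipliers (so that `G′_□∘[Δ′_□, M_h]` reads the
COLUMN entry `G′_□∘∇*_ν` of (3.42)₃); (3.100)'s Leibniz rule twice. [cite: Balaban1985BackgroundPropagators, (3.88) p.409, (3.100) p.413, (3.23) p.394, Thm 3.1 (3.42) p.397] -/
theorem lapSL_comm_cutMulY (V : CfgY 𝔸 i) (h : SiteY i → ℝ) :
    lapSL i V * cutMulY h - cutMulY h * lapSL i V =
      ∑ ν : Fin (d + 1), (cdsSL i V ν * cutMulY (fun w => h (shiftY i ν w) - h w) * (cdSL i V ν + 1) +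
          cdsSL i V ν * cutMulY (fun w => h (shiftY i ν w) - h w)) -
        cutMulY (fun z => ∑ ν : Fin (d + 1), (2 * h z - h (shiftY i ν z) - h ((shiftY i ν).symm z))) := by
  refine LinearMap.ext fun Λ => funext fun z => ?_
  rw [LinearMap.sub_apply, Pi.sub_apply, Module.End.mul_apply, Module.End.mul_apply, lapSL_apply, lapSL_apply, cutMulY_apply,
    LinearMap.sub_apply, Pi.sub_apply, LinearMap.coe_sum, Finset.sum_apply, Finset.sum_apply, cutMulY_apply, Complex.ofReal_sum,
    Finset.sum_smul]
  unfold lapS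
  rw [Finset.smul_sum, ← Finset.sum_sub_distrib, ← Finset.sum_sub_distrib]
  refine Finset.sum_congr rfl fun ν _ => ?_
  rw [LinearMap.add_apply, Pi.add_apply, Module.End.mul_apply, Module.End.mul_apply, Module.End.mul_apply, cdsSL_apply, cdsSL_apply]
  exact cdsS_cdS_comm_apply i V h ν Λ z

/-- ★★ hence for the cube operator `Δ′_{a,□}(V) = Δ_V + A_□(V)`: `Δ′_□M_h − M_hΔ′_□ = Σ_ν(…) − M_{σh} + (A_□M_h − M_hA_□)`, the averaging commutator kept whole
(it is block-local, (3.24)∕(3.59)). [cite: Balaban1985BackgroundPropagators, (3.24) p.394, (3.88) p.409, (3.100) p.413] -/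
theorem deltaPrimeACubeY_comm_cutMulY (par : SiteParY 𝔸 i) (V : CfgY 𝔸 i) (h : SiteY i → ℝ) :
    deltaPrimeACubeY i c par V * cutMulY h - cutMulY h * deltaPrimeACubeY i c par V =
      ∑ ν : Fin (d + 1), (cdsSL i V ν * cutMulY (fun w => h (shiftY i ν w) - h w) * (cdSL i V ν + 1) +
          cdsSL i V ν * cutMulY (fun w => h (shiftY i ν w) - h w)) -
        cutMulY (fun z => ∑ ν : Fin (d + 1), (2 * h z - h (shiftY i ν z) - h ((shiftY i ν).symm z))) +
        (kernelTrOpY (avgCoeffCubeY i c) (avgTrCubeY i c par V) * cutMulY h -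
          cutMulY h * kernelTrOpY (avgCoeffCubeY i c) (avgTrCubeY i c par V)) := by
  rw [← lapSL_comm_cutMulY]
  simp only [deltaPrimeACubeY, add_mul, mul_add]
  abel

end Identity

/-! ## §3  Print's units: the pieces of `G′_□∘[Δ′_□, M_χ]` as products of the (3.42) letters `η²G′_□`, `−η⁻¹∇*_ν` and `η`-free local factors -/

section Units

variable (b : Module.Basis ι ℝ 𝔸) (par : SiteParY 𝔸 i) (V : CfgY 𝔸 i)

omit [CompleteSpace 𝔸] in
/-- `M_{r·f} = r·M_f` for a real constant `r` (print's `η⁻¹∂h`, `η⁻²∂∂*h`). [cite: Balaban1985BackgroundPropagators, (3.89) p.409, bookkeeping] -/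
theorem cutMulY_const_mul_apply (r : ℝ) (f : SiteY i → ℝ) (Λ : SiteY i → 𝔸) :
    cutMulY (𝔸 := 𝔸) (fun z => r * f z) Λ = ((r : ℝ) : ℂ) • cutMulY (𝔸 := 𝔸) f Λ := by
  funext z
  rw [cutMulY_apply, Pi.smul_apply, cutMulY_apply, Complex.ofReal_mul, mul_smul]

/-- ★ the derivative piece in print's units: `G′_□∘(∇*_ν∘M_f∘Y) = −(η²G′_□)∘(−η⁻¹∇*_ν)∘M_{η⁻¹f}∘Y` (`η²·η⁻¹·η⁻¹ = 1`).
[cite: Balaban1985BackgroundPropagators, Thm 3.1 (3.42) p.397 (third member), (3.89) p.409] -/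
theorem G_cdsSL_cutMulY_mul_eq (f : SiteY i → ℝ) (ν : Fin (d + 1)) (Y : Module.End ℂ (SiteY i → 𝔸)) :
    ((GpCubeY i c par V * (cdsSL i V ν * cutMulY f * Y)).restrictScalars ℝ : Module.End ℝ (SiteY i → 𝔸)) =
      -((((kGeo i).eta ^ 2) • (GpCubeY i c par V).restrictScalars ℝ) *
          diffLetter (shiftY i) (UboxY i V) ((((kGeo i).eta : ℂ))⁻¹) (Sum.inr ν) *
          (cutMulY (𝔸 := 𝔸) (fun z => ((kGeo i).eta)⁻¹ * f z)).restrictScalars ℝ * Y.restrictScalars ℝ) := by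
  have hη : (kGeo i).eta ≠ 0 := by rw [← geoCK_eta i c]; exact (geoCK_eta_pos i c).ne'
  refine LinearMap.ext fun Λ => ?_
  rw [LinearMap.restrictScalars_apply, Module.End.mul_apply, Module.End.mul_apply, Module.End.mul_apply, cdsSL_apply,
    LinearMap.neg_apply, Module.End.mul_apply, Module.End.mul_apply, Module.End.mul_apply, LinearMap.restrictScalars_apply,
    LinearMap.restrictScalars_apply, cutMulY_const_mul_apply, diffLetter_inr_apply, cdsS_smul, LinearMap.smul_apply,
    LinearMap.restrictScalars_apply, map_neg, map_smul, map_smul, ← Complex.coe_smul, smul_neg, neg_neg, smul_smul, smul_smul]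
  rw [show (((kGeo i).eta ^ 2 : ℝ) : ℂ) * ((((kGeo i).eta : ℂ))⁻¹) * ((((kGeo i).eta)⁻¹ : ℝ) : ℂ) = 1 by
    rw [← Complex.ofReal_inv, ← Complex.ofReal_mul, ← Complex.ofReal_mul, pow_two, mul_inv_cancel_right₀ hη, mul_inv_cancel₀ hη,
      Complex.ofReal_one]]
  rw [one_smul]

/-- ★ the same without a trailing letter: `G′_□∘(∇*_ν∘M_f) = −(η²G′_□)∘(−η⁻¹∇*_ν)∘M_{η⁻¹f}`. [cite: Balaban1985BackgroundPropagators, Thm 3.1 (3.42) p.397 (third member), (3.89) p.409] -/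
theorem G_cdsSL_cutMulY_eq (f : SiteY i → ℝ) (ν : Fin (d + 1)) :
    ((GpCubeY i c par V * (cdsSL i V ν * cutMulY f)).restrictScalars ℝ : Module.End ℝ (SiteY i → 𝔸)) =
      -((((kGeo i).eta ^ 2) • (GpCubeY i c par V).restrictScalars ℝ) *
          diffLetter (shiftY i) (UboxY i V) ((((kGeo i).eta : ℂ))⁻¹) (Sum.inr ν) *
          (cutMulY (𝔸 := 𝔸) (fun z => ((kGeo i).eta)⁻¹ * f z)).restrictScalars ℝ) := by
  have h := G_cdsSL_cutMulY_mul_eq i c par V f ν 1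
  rw [mul_one] at h
  rw [h, show ((1 : Module.End ℂ (SiteY i → 𝔸)).restrictScalars ℝ : Module.End ℝ (SiteY i → 𝔸)) = 1 from rfl, mul_one]

/-- ★ the second-difference piece in print's units: `G′_□∘M_s = (η²G′_□)∘M_{η⁻²s}`. [cite: Balaban1985BackgroundPropagators, Thm 3.1 (3.42) p.397 (first member), (3.89) p.409] -/
theorem G_cutMulY_eq (s : SiteY i → ℝ) :
    ((GpCubeY i c par V * cutMulY s).restrictScalars ℝ : Module.End ℝ (SiteY i → 𝔸)) =
      (((kGeo i).eta ^ 2) • (GpCubeY i c par V).restrictScalars ℝ) * (cutMulY (𝔸 := 𝔸) (fun z => ((kGeo i).eta ^ 2)⁻¹ * s z)).restrictScalars ℝ := by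
  have hη : (kGeo i).eta ≠ 0 := by rw [← geoCK_eta i c]; exact (geoCK_eta_pos i c).ne'
  refine LinearMap.ext fun Λ => ?_
  rw [LinearMap.restrictScalars_apply, Module.End.mul_apply, Module.End.mul_apply, LinearMap.restrictScalars_apply, cutMulY_const_mul_apply,
    LinearMap.smul_apply, LinearMap.restrictScalars_apply, map_smul, ← Complex.coe_smul, smul_smul]
  rw [show (((kGeo i).eta ^ 2 : ℝ) : ℂ) * ((((kGeo i).eta ^ 2)⁻¹ : ℝ) : ℂ) = 1 by
    rw [← Complex.ofReal_mul, mul_inv_cancel₀ (pow_ne_zero 2 hη), Complex.ofReal_one]]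
  rw [one_smul]

/-- ★ the averaging piece in print's units: `G′_□∘C = (η²G′_□)∘(η⁻²C)`. [cite: Balaban1985BackgroundPropagators, Thm 3.1 (3.42) p.397, (3.24) p.394, (3.59) p.402] -/
theorem G_mul_eq_smul (C : Module.End ℂ (SiteY i → 𝔸)) :
    ((GpCubeY i c par V * C).restrictScalars ℝ : Module.End ℝ (SiteY i → 𝔸)) =
      (((kGeo i).eta ^ 2) • (GpCubeY i c par V).restrictScalars ℝ) * ((((kGeo i).eta ^ 2)⁻¹ : ℝ) • C.restrictScalars ℝ) := by
  have hη : (kGeo i).eta ≠ 0 := by rw [← geoCK_eta i c]; exact (geoCK_eta_pos i c).ne'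
  refine LinearMap.ext fun Λ => ?_
  rw [LinearMap.restrictScalars_apply, Module.End.mul_apply, Module.End.mul_apply, LinearMap.smul_apply, LinearMap.restrictScalars_apply,
    LinearMap.smul_apply, LinearMap.restrictScalars_apply, LinearMap.map_smul_of_tower, smul_smul, mul_inv_cancel₀ (pow_ne_zero 2 hη), one_smul]

omit [CompleteSpace 𝔸] in
/-- `restrictScalars` adds. [cite: Balaban1984PropagatorsII, (2.52) p.232, bookkeeping] -/
theorem restrictScalars_add' (F₁ F₂ : Module.End ℂ (SiteY i → 𝔸)) :
    ((F₁ + F₂).restrictScalars ℝ : Module.End ℝ (SiteY i → 𝔸)) = F₁.restrictScalars ℝ + F₂.restrictScalars ℝ := LinearMap.ext fun _ => rfl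

omit [CompleteSpace 𝔸] in
/-- `restrictScalars` subtracts. [cite: Balaban1984PropagatorsII, (2.52) p.232, bookkeeping] -/
theorem restrictScalars_sub' (F₁ F₂ : Module.End ℂ (SiteY i → 𝔸)) :
    ((F₁ - F₂).restrictScalars ℝ : Module.End ℝ (SiteY i → 𝔸)) = F₁.restrictScalars ℝ - F₂.restrictScalars ℝ := LinearMap.ext fun _ => rfl

omit [CompleteSpace 𝔸] in
/-- `restrictScalars` of a finite sum of letters. [cite: Balaban1984PropagatorsII, (2.52) p.232, bookkeeping] -/
theorem restrictScalars_fsum {A : Type} (s : Finset A) (F : A → Module.End ℂ (SiteY i → 𝔸)) :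
    ((∑ k ∈ s, F k).restrictScalars ℝ : Module.End ℝ (SiteY i → 𝔸)) = ∑ k ∈ s, (F k).restrictScalars ℝ := by
  refine LinearMap.ext fun Λ => ?_
  rw [LinearMap.restrictScalars_apply, LinearMap.coe_sum, LinearMap.coe_sum, Finset.sum_apply, Finset.sum_apply]
  rfl

omit [CompleteSpace 𝔸] in
/-- `conj b` of a finite sum of letters. [cite: Balaban1984PropagatorsII, (2.52) p.232 («A summation preserves it also»)] -/
theorem conj_fsum {A : Type} (s : Finset A) (F : A → Module.End ℝ (SiteY i → 𝔸)) :
    conj b (∑ k ∈ s, F k) = ∑ k ∈ s, conj b (F k) :=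
  map_sum (coordEquiv b).conj F s

omit [CompleteSpace 𝔸] in
/-- `conj b` adds. [cite: Balaban1984PropagatorsII, (2.52) p.232, bookkeeping] -/
theorem conj_add (T₁ T₂ : Module.End ℝ (SiteY i → 𝔸)) : conj b (T₁ + T₂) = conj b T₁ + conj b T₂ := map_add (coordEquiv b).conj T₁ T₂

/-- ★★ **`G′_□∘[Δ′_□, M_χ]` IN THE LETTERS OF (3.42)**, real coordinates: with `G = η²G′_□(V)`, `D_ν = −η⁻¹∇*_{V,ν}` (`diffLetter … (inr ν)`), `W_ν = M_{η⁻¹∂_νχ}`,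
`X_ν = ∇_{V,ν} + 1`, `S = M_{η⁻²σχ}`, `C = η⁻²(A_□M_χ − M_χA_□)`:
`conj b((G′_□(Δ′_□M_χ − M_χΔ′_□))^ℝ) = Σ_ν (−conj(G)conj(D_ν)conj(W_ν)conj(X_ν) − conj(G)conj(D_ν)conj(W_ν)) − conj(G)conj(S) + conj(G)conj(C)`.
[cite: Balaban1985BackgroundPropagators, (3.88)–(3.89) p.409, (3.100) p.413, Thm 3.1 (3.42) p.397; Balaban1984PropagatorsII, (2.51)–(2.52) p.232] -/
theorem conj_commStepAdj_eq :
    conj b ((GpCubeY i c par V * (deltaPrimeACubeY i c par V * cutMulY (chiY i c) - cutMulY (chiY i c) * deltaPrimeACubeY i c par V)).restrictScalars ℝ) =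
      ∑ ν : Fin (d + 1),
        (-(conj b (((kGeo i).eta ^ 2) • (GpCubeY i c par V).restrictScalars ℝ) *
            conj b (diffLetter (shiftY i) (UboxY i V) ((((kGeo i).eta : ℂ))⁻¹) (Sum.inr ν)) *
            conj b ((cutMulY (𝔸 := 𝔸) (fun z => ((kGeo i).eta)⁻¹ * (chiY i c (shiftY i ν z) - chiY i c z))).restrictScalars ℝ) *
            conj b ((cdSL i V ν + 1).restrictScalars ℝ)) -
          conj b (((kGeo i).eta ^ 2) • (GpCubeY i c par V).restrictScalars ℝ) *
            conj b (diffLetter (shiftY i) (UboxY i V) ((((kGeo i).eta : ℂ))⁻¹) (Sum.inr ν)) *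
            conj b ((cutMulY (𝔸 := 𝔸) (fun z => ((kGeo i).eta)⁻¹ * (chiY i c (shiftY i ν z) - chiY i c z))).restrictScalars ℝ)) -
      conj b (((kGeo i).eta ^ 2) • (GpCubeY i c par V).restrictScalars ℝ) *
        conj b ((cutMulY (𝔸 := 𝔸) (fun z => ((kGeo i).eta ^ 2)⁻¹ *
          ∑ ν : Fin (d + 1), (2 * chiY i c z - chiY i c (shiftY i ν z) - chiY i c ((shiftY i ν).symm z)))).restrictScalars ℝ) +
      conj b (((kGeo i).eta ^ 2) • (GpCubeY i c par V).restrictScalars ℝ) *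
        conj b ((((kGeo i).eta ^ 2)⁻¹ : ℝ) • (kernelTrOpY (avgCoeffCubeY i c) (avgTrCubeY i c par V) * cutMulY (chiY i c) -
          cutMulY (chiY i c) * kernelTrOpY (avgCoeffCubeY i c) (avgTrCubeY i c par V)).restrictScalars ℝ) := by
  rw [deltaPrimeACubeY_comm_cutMulY, mul_add, mul_sub, Finset.mul_sum, restrictScalars_add', restrictScalars_sub', restrictScalars_fsum,
    conj_add, conj_sub, conj_fsum, G_cutMulY_eq, B9Eq352DivFormLetters.conj_mul, G_mul_eq_smul, B9Eq352DivFormLetters.conj_mul]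
  congr 1
  congr 1
  refine Finset.sum_congr rfl fun ν _ => ?_
  rw [mul_add (GpCubeY i c par V), restrictScalars_add', conj_add, G_cdsSL_cutMulY_mul_eq, G_cdsSL_cutMulY_eq, conj_neg, conj_neg,
    B9Eq352DivFormLetters.conj_mul, B9Eq352DivFormLetters.conj_mul, B9Eq352DivFormLetters.conj_mul, sub_eq_add_neg]

end Units

/-! ## §4  ★★★ The member-uniform block majorant of `conj b((G′_□(V)·[Δ′_{a,□}(V), M_{χ_□}])^ℝ)` over the cube sequence's blocks -/

section Main

variable (b : Module.Basis ι ℝ 𝔸) (par : SiteParY 𝔸 i) (V : CfgY 𝔸 i)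

omit [CompleteSpace 𝔸] in
/-- majorants subtract. [cite: Balaban1984PropagatorsII, (2.52) p.232 («A summation preserves it also»), bookkeeping] -/
theorem hasMajorant_sub' {X : Type} {g : B6.Geometry} (blk : X → g.Site) {T₁ T₂ : Module.End ℝ (X → ℝ)} {K₁ K₂ : g.Site → g.Site → ℝ}
    (h₁ : HasMajorant (g := g) blk T₁ K₁) (h₂ : HasMajorant (g := g) blk T₂ K₂) :
    HasMajorant (g := g) blk (T₁ - T₂) (fun a a' => K₁ a a' + K₂ a a') := by
  rw [sub_eq_add_neg]; exact hasMajorant_add (g := g) blk h₁ (hasMajorant_neg blk h₂)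

/-- slowing a decay rate costs nothing: `e^{−θt} ≤ e^{−(1−α′)θt}` for `t, θ, α′ ≥ 0`. [cite: Balaban1984PropagatorsII, (2.54) p.233, bookkeeping] -/
theorem exp_rate_weaken {θ α' t : ℝ} (ht : 0 ≤ t) (hθ : 0 ≤ θ) (hα' : 0 ≤ α') :
    Real.exp (-(θ * t)) ≤ Real.exp (-((1 - α') * θ * t)) :=
  Real.exp_le_exp.2 (by nlinarith [mul_nonneg (mul_nonneg hα' hθ) ht])

/-- `|η⁻¹∂_νχ_□(z)| ≤ (D₁θ∕4)·ℓ_□(z)⁻¹` ([4] p. 247 «|∂h_□| ≤ O(1)(MLʲη)⁻¹», the plateau cut-off's first weight).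
[cite: Balaban1984PropagatorsII, p.247; Balaban1985BackgroundPropagators, (3.89) p.409] -/
theorem abs_dchi_le (ν : Fin (d + 1)) (z : SiteY i) :
    |((kGeo i).eta)⁻¹ * (chiY i c (shiftY i ν z) - chiY i c z)| ≤ D1 thetaProf / 4 * ((geoCK i c).len (blkCubeY i c z))⁻¹ := by
  have hl := geoCK_len_pos i c (blkCubeY i c z)
  rw [← div_eq_mul_inv, le_div_iff₀ hl]
  exact (chiY_weights i c ν z).2.2.2.1

/-- `|η⁻²σχ_□(z)| ≤ (d+1)(3D₂θ∕16)·ℓ_□(z)⁻²`, `σχ = Σ_ν(2χ − χ(·+e_ν) − χ(·−e_ν))` ([4] p. 247 «|Δh_□| ≤ O(1)(MLʲη)⁻²», the second weight).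
[cite: Balaban1984PropagatorsII, p.247; Balaban1985BackgroundPropagators, (3.89) p.409] -/
theorem abs_sigma_chi_le (z : SiteY i) :
    |((kGeo i).eta ^ 2)⁻¹ * ∑ ν : Fin (d + 1), (2 * chiY i c z - chiY i c (shiftY i ν z) - chiY i c ((shiftY i ν).symm z))| ≤
      ((d : ℝ) + 1) * (3 * D2 thetaProf / 16) * ((geoCK i c).len (blkCubeY i c z) ^ 2)⁻¹ := by
  have hl := pow_pos (geoCK_len_pos i c (blkCubeY i c z)) 2
  have hterm : ∀ ν : Fin (d + 1), |((kGeo i).eta ^ 2)⁻¹ * (2 * chiY i c z - chiY i c (shiftY i ν z) - chiY i c ((shiftY i ν).symm z))| ≤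
      3 * D2 thetaProf / 16 * ((geoCK i c).len (blkCubeY i c z) ^ 2)⁻¹ := fun ν => by
    have h6 := (chiY_weights i c ν z).2.2.2.2.2
    have e : ((kGeo i).eta ^ 2)⁻¹ * (2 * chiY i c z - chiY i c (shiftY i ν z) - chiY i c ((shiftY i ν).symm z)) =
        -(((kGeo i).eta ^ 2)⁻¹ * (chiY i c (shiftY i ν z) - 2 * chiY i c z + chiY i c ((shiftY i ν).symm z))) := by ring
    rw [e, abs_neg, ← div_eq_mul_inv, le_div_iff₀ hl]
    exact h6
  rw [Finset.mul_sum]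
  calc |∑ ν : Fin (d + 1), ((kGeo i).eta ^ 2)⁻¹ * (2 * chiY i c z - chiY i c (shiftY i ν z) - chiY i c ((shiftY i ν).symm z))|
      ≤ ∑ ν : Fin (d + 1), |((kGeo i).eta ^ 2)⁻¹ * (2 * chiY i c z - chiY i c (shiftY i ν z) - chiY i c ((shiftY i ν).symm z))| :=
        Finset.abs_sum_le_sum_abs _ _
    _ ≤ ∑ _ν : Fin (d + 1), 3 * D2 thetaProf / 16 * ((geoCK i c).len (blkCubeY i c z) ^ 2)⁻¹ := Finset.sum_le_sum fun ν _ => hterm ν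
    _ = _ := by rw [Finset.sum_const, Finset.card_univ, Fintype.card_fin, nsmul_eq_mul]; push_cast; ring

/-- ★ **THE AVERAGING COMMUTATOR `η⁻²[A_□(V), M_{χ_□}]` IS BLOCK-LOCAL OF SIZE `2(1 + C_qα₁)²·ℓ_□⁻²`** ((3.24)'s averaging term reads its own block; (3.19)∕(3.59) sizes,
`|χ_□| ≤ 1`). [cite: Balaban1985BackgroundPropagators, (3.24) p.394, (3.19) p.393, (3.59) p.402, p.409; Balaban1984PropagatorsI, (1.118) p.36] -/
theorem norm_avgComm_apply_le (h1 : ‖(1 : 𝔸)‖ ≤ 1) (hpar : ∀ z w, par (fun _ _ => 1) z w = 1) {Cq α₁ : ℝ} (hCq : 0 ≤ Cq) (hα : 0 ≤ α₁)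
    (hkF : ∀ (y : BlkCubeY i c) (x : SiteY i), blkCubeY i c x = y → ‖kFCubeY i c par (fun _ _ => 1) V y x‖ ≤ Cq * α₁ * wK i c y)
    (hsF : ∀ x : SiteY i, ‖sFCubeY i c par (fun _ _ => 1) V x‖ ≤ Cq * α₁)
    (f : SiteY i → 𝔸) (z : SiteY i) (Bf : ℝ) (hBf : ∀ x', blkCubeY i c x' = blkCubeY i c z → ‖f x'‖ ≤ Bf) :
    ‖((((kGeo i).eta ^ 2)⁻¹ : ℝ) • (kernelTrOpY (avgCoeffCubeY i c) (avgTrCubeY i c par V) * cutMulY (chiY i c) -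
        cutMulY (chiY i c) * kernelTrOpY (avgCoeffCubeY i c) (avgTrCubeY i c par V)).restrictScalars ℝ) f z‖ ≤
      2 * (1 + Cq * α₁) ^ 2 * ((geoCK i c).len (blkCubeY i c z) ^ 2)⁻¹ * Bf := by
  have hχf : ∀ x', blkCubeY i c x' = blkCubeY i c z → ‖cutMulY (chiY i c) f x'‖ ≤ Bf := fun x' hx' => by
    rw [cutMulY_apply, B9Thm37CubeCoverCommutatorSizes.norm_ofReal_smul]
    calc |chiY i c x'| * ‖f x'‖ ≤ 1 * ‖f x'‖ := mul_le_mul_of_nonneg_right (abs_chiY_le_one i c x').1 (norm_nonneg _)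
      _ ≤ Bf := by rw [one_mul]; exact hBf x' hx'
  have hA1 := norm_avgCube_apply_le i c par h1 hpar V hCq hα hkF hsF (cutMulY (chiY i c) f) z Bf hχf
  have hA2 := norm_avgCube_apply_le i c par h1 hpar V hCq hα hkF hsF f z Bf hBf
  rw [LinearMap.smul_apply, LinearMap.restrictScalars_apply] at hA1 hA2
  rw [LinearMap.smul_apply, LinearMap.restrictScalars_apply, LinearMap.sub_apply, Module.End.mul_apply, Module.End.mul_apply, smul_sub,
    Pi.sub_apply]
  have h2 : ‖(((kGeo i).eta ^ 2)⁻¹ • cutMulY (chiY i c) (kernelTrOpY (avgCoeffCubeY i c) (avgTrCubeY i c par V) f)) z‖ ≤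
      (1 + Cq * α₁) ^ 2 * ((geoCK i c).len (blkCubeY i c z) ^ 2)⁻¹ * Bf := by
    rw [Pi.smul_apply, cutMulY_apply, smul_comm, B9Thm37CubeCoverCommutatorSizes.norm_ofReal_smul, ← Pi.smul_apply]
    calc |chiY i c z| * ‖(((kGeo i).eta ^ 2)⁻¹ • kernelTrOpY (avgCoeffCubeY i c) (avgTrCubeY i c par V) f) z‖
        ≤ 1 * ((1 + Cq * α₁) ^ 2 * ((geoCK i c).len (blkCubeY i c z) ^ 2)⁻¹ * Bf) :=
          mul_le_mul (abs_chiY_le_one i c z).1 hA2 (norm_nonneg _) zero_le_one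
      _ = _ := one_mul _
  calc ‖(((kGeo i).eta ^ 2)⁻¹ • kernelTrOpY (avgCoeffCubeY i c) (avgTrCubeY i c par V) (cutMulY (chiY i c) f)) z -
        (((kGeo i).eta ^ 2)⁻¹ • cutMulY (chiY i c) (kernelTrOpY (avgCoeffCubeY i c) (avgTrCubeY i c par V) f)) z‖
      ≤ (1 + Cq * α₁) ^ 2 * ((geoCK i c).len (blkCubeY i c z) ^ 2)⁻¹ * Bf + (1 + Cq * α₁) ^ 2 * ((geoCK i c).len (blkCubeY i c z) ^ 2)⁻¹ * Bf :=
        (norm_sub_le _ _).trans (add_le_add hA1 h2)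
    _ = _ := by ring

/-- ★★★ **THE ADJOINT-ORDERED COMMUTATOR STEP `T_χ = G′_□(V)·(Δ′_{a,□}(V)M_{χ_□} − M_{χ_□}Δ′_{a,□}(V))` HAS A MEMBER-UNIFORM BLOCK MAJORANT `θ_T·e^{−(1−α′)(1−α)δ·d_□}`**
over the cube sequence's blocks (`geoCK`, block map `blkCubeY`), from: entry 0 of (3.42) for `G′_□(V)` — `conj b(η²G′_□) ≺ B_fℓ²e^{−δd}` —, the COLUMN entry
(3.42)₃ — `conj b(η²G′_□)·conj b(−η⁻¹∇*_{V,μ}) ≺ B_fℓe^{−δd}` —, a bound `‖R(V_ν(z))a‖ ≤ κ_V‖a‖` on the field's rotations, the (3.59) sizes of the averaging word,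
[4] (2.60) for the weights `ℓ⁻¹`, `ℓ⁻²` at the exponent `α`, and (2.61) at `((1−α)δ, α′)`.  Mechanism: §2's summation by parts puts every derivative in front
of the cut-off's weights `η⁻¹∂χ_□` (`≤ D₁θ∕4·ℓ_□⁻¹`), `η⁻²σχ_□` (`≤ (d+1)·3D₂θ∕16·ℓ_□⁻²`), whose inverse lengths are transferred to the row by (2.60) against
the `ℓ` resp. `ℓ²` of the entries; the covariant shift and the averaging commutator are short-range ∕ block-local.  The constant
`θ_T = (d+1)·B_f(D₁θ∕4)Λ₁·(M₂Σ‖b_j‖κ_Ve^{(1−α)δ}c₁² + 1) + (d+1)B_f(3D₂θ∕16)Λ₂ + 2(1 + C_qα₁)²M₂Σ‖b_j‖B_fΛ₂` carries NO `L^j`, NO `η` (member-uniform); no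
`O(M⁻¹)` is claimed. The mirror of p21 D3 `hasMajorant_conj_commStep` (there `[M_χ, Δ′_□]·G′_□`, rows in the annulus; here `G′_□·[Δ′_□, M_χ]`, columns in
the annulus). [cite: Balaban1985BackgroundPropagators, (3.88)–(3.89) p.409, (3.100) p.413, Thm 3.1 (3.42) p.397, (3.24) p.394, (3.59) p.402, p.412 l.1–9; Balaban1984PropagatorsII, p.247, (2.51)–(2.55) pp.232–233, Lemma 2.1 (2.60)–(2.61) p.234] -/
theorem hasMajorant_conj_commStepAdj {M₂ : ℝ} (hM₂ : 0 ≤ M₂) (hrepr : ∀ (v : 𝔸) (j : ι), |b.repr v j| ≤ M₂ * ‖v‖) (h1A : ‖(1 : 𝔸)‖ ≤ 1)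
    (Rr : ℝ) (H : Prop) (hpar : ∀ z w, par (fun _ _ => 1) z w = 1)
    {κV Cq α₁ Bf δ α α' Λ₁ Λ₂ : ℝ} (hκV : 0 ≤ κV) (hRV : ∀ (ν : Fin (d + 1)) (z : SiteY i) (a : 𝔸), ‖R (UboxY i V ν z) a‖ ≤ κV * ‖a‖)
    (hCq : 0 ≤ Cq) (hα₁ : 0 ≤ α₁)
    (hkF : ∀ (y : BlkCubeY i c) (x : SiteY i), blkCubeY i c x = y → ‖kFCubeY i c par (fun _ _ => 1) V y x‖ ≤ Cq * α₁ * wK i c y)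
    (hsF : ∀ x : SiteY i, ‖sFCubeY i c par (fun _ _ => 1) V x‖ ≤ Cq * α₁)
    (hBf : 0 ≤ Bf) (hδ : 0 ≤ δ) (hα1 : α ≤ 1) (hα'0 : 0 ≤ α') (hα'1 : α' ≤ 1) (hΛ₁ : 0 ≤ Λ₁) (hΛ₂ : 0 ≤ Λ₂) (dB : ℕ)
    (hST₁ : ∀ a e : BlkCubeY i c, Real.exp (-(α * δ * (geoCK i c).dist a e)) * ((geoCK i c).len e)⁻¹ ≤ Λ₁ * ((geoCK i c).len a)⁻¹)
    (hST₂ : ∀ a e : BlkCubeY i c, Real.exp (-(α * δ * (geoCK i c).dist a e)) * ((geoCK i c).len e ^ 2)⁻¹ ≤ Λ₂ * ((geoCK i c).len a ^ 2)⁻¹)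
    (h261 : Ineq261 dB (toB6 (geoCK i c) Rr H) ((1 - α) * δ) α')
    (hG : HasMajorant (g := toB6 (geoCK i c) Rr H) (fun p : SiteY i × ι => blkCubeY i c p.1)
      (conj b (((kGeo i).eta ^ 2) • (GpCubeY i c par V).restrictScalars ℝ))
      (fun a a' => Bf * (geoCK i c).len a ^ 2 * Real.exp (-(δ * (geoCK i c).dist a a'))))
    (hGDb : ∀ μ : Fin (d + 1), HasMajorant (g := toB6 (geoCK i c) Rr H) (fun p : SiteY i × ι => blkCubeY i c p.1)
      (conj b (((kGeo i).eta ^ 2) • (GpCubeY i c par V).restrictScalars ℝ) *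
        conj b (diffLetter (shiftY i) (UboxY i V) ((((kGeo i).eta : ℂ))⁻¹) (Sum.inr μ)))
      (fun a a' => Bf * (geoCK i c).len a * Real.exp (-(δ * (geoCK i c).dist a a')))) :
    HasMajorant (g := toB6 (geoCK i c) Rr H) (fun p : SiteY i × ι => blkCubeY i c p.1)
      (conj b ((GpCubeY i c par V * (deltaPrimeACubeY i c par V * cutMulY (chiY i c) - cutMulY (chiY i c) * deltaPrimeACubeY i c par V)).restrictScalars ℝ))
      (fun a a' => (((d : ℝ) + 1) * (Bf * (D1 thetaProf / 4) * Λ₁ * (M₂ * (∑ j, ‖b j‖) * κV * Real.exp ((1 - α) * δ)) * B6.c1 dB ((1 - α) * δ) α' ^ 2 +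
            Bf * (D1 thetaProf / 4) * Λ₁) +
          Bf * (((d : ℝ) + 1) * (3 * D2 thetaProf / 16)) * Λ₂ + Bf * (2 * (1 + Cq * α₁) ^ 2 * (M₂ * ∑ j, ‖b j‖)) * Λ₂) *
        Real.exp (-((1 - α') * ((1 - α) * δ) * (geoCK i c).dist a a'))) := by
  have hD1 := D1_nonneg contDiff_thetaProf hasCompactSupport_thetaProf
  have hD2 := D2_nonneg contDiff_thetaProf hasCompactSupport_thetaProf
  have hSb : 0 ≤ ∑ j, ‖b j‖ := Finset.sum_nonneg fun _ _ => norm_nonneg _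
  have hMS : 0 ≤ M₂ * ∑ j, ‖b j‖ := mul_nonneg hM₂ hSb
  obtain ⟨hdnn, htri, -, -⟩ := geoCK_dist_axioms i c Rr H
  have hδ' : 0 ≤ (1 - α) * δ := mul_nonneg (by linarith) hδ
  have hlen : ∀ a : BlkCubeY i c, 0 < (geoCK i c).len a := geoCK_len_pos i c
  set η : ℝ := (kGeo i).eta with hηdef
  set G : Module.End ℝ (SiteY i × ι → ℝ) := conj b ((η ^ 2) • (GpCubeY i c par V).restrictScalars ℝ) with hGdef
  set D : Fin (d + 1) → Module.End ℝ (SiteY i × ι → ℝ) := fun ν => conj b (diffLetter (shiftY i) (UboxY i V) (((η : ℂ))⁻¹) (Sum.inr ν)) with hDdef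
  set W : Fin (d + 1) → Module.End ℝ (SiteY i × ι → ℝ) := fun ν =>
    conj b ((cutMulY (𝔸 := 𝔸) (fun z => η⁻¹ * (chiY i c (shiftY i ν z) - chiY i c z))).restrictScalars ℝ) with hWdef
  set X : Fin (d + 1) → Module.End ℝ (SiteY i × ι → ℝ) := fun ν => conj b ((cdSL i V ν + 1).restrictScalars ℝ) with hXdef
  set E : BlkCubeY i c → BlkCubeY i c → ℝ := fun a a' => Real.exp (-((1 - α') * ((1 - α) * δ) * (geoCK i c).dist a a')) with hEdef
  have hweak : ∀ a a', Real.exp (-((1 - α) * δ * (geoCK i c).dist a a')) ≤ E a a' := fun a a' => exp_rate_weaken (hdnn a a') hδ' hα'0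
  -- (m1a) the derivative letter with the weight `η⁻¹∂_νχ` at the source end
  have hEW : ∀ ν, HasMajorant (g := toB6 (geoCK i c) Rr H) (fun p : SiteY i × ι => blkCubeY i c p.1) (G * D ν * W ν)
      (fun a a' => Bf * (geoCK i c).len a * Real.exp (-(δ * (geoCK i c).dist a a')) * (D1 thetaProf / 4 * ((geoCK i c).len a')⁻¹)) := fun ν => by
    have h := hasMajorant_mul_mulOp_colWeight (g := toB6 (geoCK i c) Rr H) (fun p : SiteY i × ι => blkCubeY i c p.1) (hGDb ν)
      (fun p : SiteY i × ι => η⁻¹ * (chiY i c (shiftY i ν p.1) - chiY i c p.1)) (fun a => D1 thetaProf / 4 * ((geoCK i c).len a)⁻¹)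
      (fun a => mul_nonneg (by positivity) (inv_nonneg.2 (hlen a).le)) (fun p => abs_dchi_le i c ν p.1)
    rw [← conj_cutMulY b (fun z : SiteY i => η⁻¹ * (chiY i c (shiftY i ν z) - chiY i c z))] at h
    exact h
  -- (m1) followed by the covariant shift: the ℓ-free kernel by §1
  have hP1a : ∀ ν, HasMajorant (g := toB6 (geoCK i c) Rr H) (fun p : SiteY i × ι => blkCubeY i c p.1) (G * D ν * W ν * X ν)
      (fun a a' => Bf * (D1 thetaProf / 4) * Λ₁ * (M₂ * (∑ j, ‖b j‖) * κV * Real.exp ((1 - α) * δ)) * B6.c1 dB ((1 - α) * δ) α' ^ 2 * E a a') :=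
    fun ν => hasMajorant_weighted_mul_shift_one i c Rr H (fun p : SiteY i × ι => blkCubeY i c p.1) dB (by positivity) hBf hΛ₁ (by positivity) hδ' hα'1
      htri hST₁ h261 (hEW ν) (hasMajorant_conj_covShift i c b hM₂ hrepr Rr H V hκV hRV hδ' ν)
  -- (m2) the derivative letter alone: one pointwise transfer of `ℓ⁻¹`
  have hP1b : ∀ ν, HasMajorant (g := toB6 (geoCK i c) Rr H) (fun p : SiteY i × ι => blkCubeY i c p.1) (G * D ν * W ν)
      (fun a a' => Bf * (D1 thetaProf / 4) * Λ₁ * E a a') := fun ν =>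
    hasMajorant_mono (g := toB6 (geoCK i c) Rr H) _ (hEW ν) fun a a' =>
      (weight_transfer_pointwise (by positivity) hBf (hlen a) (hST₁ a a')).trans (mul_le_mul_of_nonneg_left (hweak a a') (by positivity))
  -- (m3) the second-difference weight at the source end: one pointwise transfer of `ℓ⁻²`
  have hP0 : HasMajorant (g := toB6 (geoCK i c) Rr H) (fun p : SiteY i × ι => blkCubeY i c p.1)
      (G * conj b ((cutMulY (𝔸 := 𝔸) (fun z => (η ^ 2)⁻¹ *
        ∑ ν : Fin (d + 1), (2 * chiY i c z - chiY i c (shiftY i ν z) - chiY i c ((shiftY i ν).symm z)))).restrictScalars ℝ))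
      (fun a a' => Bf * (((d : ℝ) + 1) * (3 * D2 thetaProf / 16)) * Λ₂ * E a a') := by
    have h := hasMajorant_mul_mulOp_colWeight (g := toB6 (geoCK i c) Rr H) (fun p : SiteY i × ι => blkCubeY i c p.1) hG
      (fun p : SiteY i × ι => (η ^ 2)⁻¹ * ∑ ν : Fin (d + 1), (2 * chiY i c p.1 - chiY i c (shiftY i ν p.1) - chiY i c ((shiftY i ν).symm p.1)))
      (fun a => ((d : ℝ) + 1) * (3 * D2 thetaProf / 16) * ((geoCK i c).len a ^ 2)⁻¹)
      (fun a => mul_nonneg (by positivity) (inv_nonneg.2 (pow_pos (hlen a) 2).le)) (fun p => abs_sigma_chi_le i c p.1)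
    rw [← conj_cutMulY b (fun z : SiteY i => (η ^ 2)⁻¹ *
      ∑ ν : Fin (d + 1), (2 * chiY i c z - chiY i c (shiftY i ν z) - chiY i c ((shiftY i ν).symm z)))] at h
    refine hasMajorant_mono (g := toB6 (geoCK i c) Rr H) _ h fun a a' => ?_
    exact (weight_transfer_pointwise (by positivity) hBf (pow_pos (hlen a) 2) (hST₂ a a')).trans (mul_le_mul_of_nonneg_left (hweak a a') (by positivity))
  -- (m4) the averaging commutator: block-local
  have hP2 : HasMajorant (g := toB6 (geoCK i c) Rr H) (fun p : SiteY i × ι => blkCubeY i c p.1)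
      (G * conj b ((((η ^ 2)⁻¹ : ℝ)) • (kernelTrOpY (avgCoeffCubeY i c) (avgTrCubeY i c par V) * cutMulY (chiY i c) -
        cutMulY (chiY i c) * kernelTrOpY (avgCoeffCubeY i c) (avgTrCubeY i c par V)).restrictScalars ℝ))
      (fun a a' => Bf * (2 * (1 + Cq * α₁) ^ 2 * (M₂ * ∑ j, ‖b j‖)) * Λ₂ * E a a') := by
    have hloc := rowLocal_conj_of_local b (blkCubeY i c) (fun s => 2 * (1 + Cq * α₁) ^ 2 * ((geoCK i c).len s ^ 2)⁻¹) hM₂ hrepr _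
      (fun f x Bf' hBf' => norm_avgComm_apply_le i c par V h1A hpar hCq hα₁ hkF hsF f x Bf' hBf')
    have h := hasMajorant_mul_of_rowLocal_right (g := toB6 (geoCK i c) Rr H) (fun p : SiteY i × ι => blkCubeY i c p.1)
      (fun s => 2 * (1 + Cq * α₁) ^ 2 * ((geoCK i c).len s ^ 2)⁻¹ * (M₂ * ∑ j, ‖b j‖))
      (fun s => mul_nonneg (mul_nonneg (by positivity) (inv_nonneg.2 (pow_pos (hlen s) 2).le)) hMS) hloc hG
    refine hasMajorant_mono (g := toB6 (geoCK i c) Rr H) _ h fun a a' => ?_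
    have ht := weight_transfer_pointwise (r := 2 * (1 + Cq * α₁) ^ 2 * (M₂ * ∑ j, ‖b j‖)) (by positivity) hBf (pow_pos (hlen a) 2) (hST₂ a a')
    calc Bf * (geoCK i c).len a ^ 2 * Real.exp (-(δ * (geoCK i c).dist a a')) * (2 * (1 + Cq * α₁) ^ 2 * ((geoCK i c).len a' ^ 2)⁻¹ * (M₂ * ∑ j, ‖b j‖))
        = Bf * (geoCK i c).len a ^ 2 * Real.exp (-(δ * (geoCK i c).dist a a')) * (2 * (1 + Cq * α₁) ^ 2 * (M₂ * ∑ j, ‖b j‖) * ((geoCK i c).len a' ^ 2)⁻¹) := by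
          ring
      _ ≤ Bf * (2 * (1 + Cq * α₁) ^ 2 * (M₂ * ∑ j, ‖b j‖)) * Λ₂ * Real.exp (-((1 - α) * δ * (geoCK i c).dist a a')) := ht
      _ ≤ _ := mul_le_mul_of_nonneg_left (hweak a a') (by positivity)
  -- assembly along §3's identity
  have hsum := hasMajorant_finset_sum (g := toB6 (geoCK i c) Rr H) (fun p : SiteY i × ι => blkCubeY i c p.1) Finset.univ
    (fun ν => -(G * D ν * W ν * X ν) - G * D ν * W ν) _ fun ν _ => hasMajorant_sub' _ (hasMajorant_neg _ (hP1a ν)) (hP1b ν)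
  have hall := hasMajorant_add (g := toB6 (geoCK i c) Rr H) _ (hasMajorant_sub' _ hsum hP0) hP2
  refine hasMajorant_mono (g := toB6 (geoCK i c) Rr H) _ (hasMajorant_congr_op hall (conj_commStepAdj_eq i c b par V).symm) fun a a' => le_of_eq ?_
  simp only [Finset.sum_const, Finset.card_univ, Fintype.card_fin, nsmul_eq_mul, hEdef]
  push_cast
  ring

end Main

end Literature.MathematicalPhysics.QuantumFieldTheory.Balaban1983to89.B9ThmDCommutatorStepAdj

end
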